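import Mathlib.GroupTheory.DoubleCoset
import Mathlib.GroupTheory.GroupAction.Quotient
import Mathlib.GroupTheory.Index
import Mathlib.Algebra.BigOperators.Finprod
import Mathlib.Data.Set.Card
import Mathlib.Tactic.Group
import HarnessLib

/-!
# The number of double cosets `|H\G/K|` through stabilizers and the normalizer of `K` (Rojas, Lemma 3.3)

Topic `GroupTheory/PermutationGroups`, theorems only, in Mathlib's language (`DoubleCoset.Quotient`,
`MulAction.orbitRel.Quotient`, `stabilizer`, `Subgroup.normalizer`, `relIndex`, `finsum`). A. M. Rojas, *Group
actions on Jacobian varieties*, Rev. Mat. Iberoam. 23 (2007), as printed (p. 403; `K^{l⁻¹} := {lgl⁻¹ : g ∈ K}`,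
p. 401):

> **Lemma 3.3.** Let `G` be a finite group having subgroups `H` and `K`, and let `H\G/K` be the corresponding set
> of double cosets. Then its cardinality is given by `|H\G/K| = Σ_{l ∈ Ω_K} [N_G(K) : K] · |K^{l⁻¹} ∩ H| / |H|`,
> where `Ω_K` is a left transversal of `N_G(K)` in `G`.
> *Proof.* Set `n = |H\G/K|` and consider the action of `H` on the left cosets `I_K` of `K` in `G` given by
> multiplication on the left. Then the stabilizer of `g_i ∈ I_K` in `H` is `K^{g_i⁻¹} ∩ H`, and therefore the
> cardinality of the orbit of `g_i` under `H` is `[H : K^{g_i⁻¹} ∩ H]`. Let `k = |I_K/H|` be the number of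
> different orbits under the action of `H` on `I_K`. … Hence `k = n`; that is, `|I_K/H| = |H\G/K|`. On the other
> hand, consider the action of `G` on `I_K` given by multiplication on the left. Then the stabilizer of `g_i ∈ I_K`
> in `G` is `K^{g_i⁻¹}`. … we have the set `I_K` divided into `[G : N_G(K)]` packages, and each package has
> `[N_G(K) : K]` points associated to the same stabilizer. Consider now the action restricted to `H ≤ G`. Then the
> stabilizer in `H` of an element `g_i ∈ I_K` is `K^{g_i⁻¹} ∩ H`. Therefore, the cardinality of the orbit
> `|O_H(g_iK)|` is `|H|/|K^{g_i⁻¹} ∩ H|`. Considering the action of `H`, for each package of points with the same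
> stabilizer in `G` we will have `[N_G(K) : K] · |K^{g_i⁻¹} ∩ H| / |H|` points in `I_K/H`. Taking all the
> representatives of left cosets of `N_G(K)`, we obtain all the packages of points in `I_K`, and therefore the
> cardinality of `I_K/H`.

Here `G` is any finite group, `H K : Subgroup G`, `N = Subgroup.normalizer ↑K`; the left transversal `Ω_K` is
`q.out` for `q : G ⧸ N`, and `K^{l⁻¹} = lKl⁻¹ = K.map (MulAut.conj l)`. The formula is proved cleared of the
denominator: `|H| · |H\G/K| = [N_G(K) : K] · Σ_{q ∈ G/N_G(K)} |q.out K q.out⁻¹ ∩ H|`. The count «for each package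
… `[N_G(K):K] · |K^{g_i⁻¹} ∩ H| / |H|` points in `I_K/H`» is the orbit-counting identity
`|H| · #(I_K/H) = Σ_{x ∈ I_K} |Stab_H(x)|` (Burnside's bijection, Mathlib `MulAction.sigmaFixedByEquivOrbitsProdGroup`)
followed by grouping the cosets `gK` along `G → G/K` and `G → G/N_G(K)` (`Σ_{g ∈ G} F(gKg⁻¹)` computed twice).

## What is proved

* `orbitRel_quotientGroup_mk_iff` (`HaK = HbK` iff `aK`, `bK` are in the same `H`-orbit),
  **`natCard_orbitRel_quotient_eq_natCard_doubleCoset`** («`|I_K/H| = |H\G/K|`»);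
* **`card_mul_natCard_orbitRel_quotient_eq_finsum`** (`|L| · #(X/L) = Σ_x |Stab_L(x)|` for a finite group `L`
  acting on a finite `X`);
* `stabilizer_quotientGroup_mk` («the stabilizer of `g_i ∈ I_K` in `G` is `K^{g_i⁻¹}`» `= g_iKg_i⁻¹`),
  `card_stabilizer_subgroup_eq` («the stabilizer in `H` … is `K^{g_i⁻¹} ∩ H`», as a cardinality);
* `finsum_eq_card_mul_finsum_quotient_out` (`Σ_{g ∈ G} φ(g) = |S| · Σ_{q ∈ G/S} φ(q.out)` for `φ` constant on
  left cosets of `S`), `finsum_stabilizer_quotient_eq_relIndex_mul_finsum` («`I_K` divided into `[G : N_G(K)]`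
  packages, and each package has `[N_G(K) : K]` points associated to the same stabilizer»:
  `Σ_{x ∈ G/K} F(Stab_G x) = [N_G(K):K] · Σ_{q ∈ G/N_G(K)} F(q.out K q.out⁻¹)`);
* `card_mul_natCard_doubleCoset_quotient_eq_finsum` (`|H| · |H\G/K| = Σ_{x ∈ G/K} |Stab_G(x) ∩ H|`) and
  **LEMMA 3.3 `card_mul_natCard_doubleCoset_quotient`**
  (`|H| · |H\G/K| = [N_G(K) : K] · Σ_{q ∈ G/N_G(K)} |q.out K q.out⁻¹ ∩ H|`).

## References

* A. M. Rojas, *Group actions on Jacobian varieties*, Rev. Mat. Iberoam. 23 (2007), 397–420, Lemma 3.3 with proof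
  (p. 403), §3 (p. 401). [Rojas2007]
-/

namespace Literature.GroupTheory.PermutationGroups

open MulAction

variable {G : Type*} [Group G]

/-! ### «`|I_K/H| = |H\G/K|`»: `H`-orbits on `G/K` are double cosets -/

/-- `aK` and `bK` lie in the same `H`-orbit of `I_K = G/K` iff `HaK = HbK`. [cite: Rojas2007, Lemma 3.3 (proof: «`|I_K/H| = |H\G/K|`»), p. 403] -/
theorem orbitRel_quotientGroup_mk_iff (H K : Subgroup G) (a b : G) :
    orbitRel H (G ⧸ K) (a : G ⧸ K) (b : G ⧸ K) ↔ DoubleCoset.mk H K a = DoubleCoset.mk H K b := by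
  rw [orbitRel_apply, mem_orbit_iff, DoubleCoset.eq]
  constructor
  · rintro ⟨h, hh⟩
    change (((h : G) * b : G) : G ⧸ K) = (a : G ⧸ K) at hh
    rw [QuotientGroup.eq] at hh
    have hk : a⁻¹ * ((h : G) * b) ∈ K := by
      have := inv_mem hh
      rwa [mul_inv_rev, inv_inv] at this
    exact ⟨(h : G)⁻¹, inv_mem h.2, a⁻¹ * ((h : G) * b), hk, by group⟩
  · rintro ⟨h, hh, k, hk, rfl⟩
    refine ⟨⟨h⁻¹, inv_mem hh⟩, ?_⟩
    change ((h⁻¹ * (h * a * k) : G) : G ⧸ K) = (a : G ⧸ K)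
    rw [QuotientGroup.eq, show (h⁻¹ * (h * a * k))⁻¹ * a = k⁻¹ by group]
    exact inv_mem hk

/-- **«`|I_K/H| = |H\G/K|`»**: the number of `H`-orbits on the left cosets `I_K = G/K` (action by left
multiplication) is the number of double cosets `H\G/K`. [cite: Rojas2007, Lemma 3.3 (proof), p. 403] -/
theorem natCard_orbitRel_quotient_eq_natCard_doubleCoset (H K : Subgroup G) :
    Nat.card (orbitRel.Quotient H (G ⧸ K)) = Nat.card (DoubleCoset.Quotient (H : Set G) K) := by
  symm
  refine Nat.card_eq_of_bijective
    (Quotient.lift (s := DoubleCoset.setoid (H : Set G) K)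
      (fun g : G ↦ (Quotient.mk (orbitRel H (G ⧸ K)) (g : G ⧸ K) : orbitRel.Quotient H (G ⧸ K)))
      fun a b hab ↦ Quotient.sound ((orbitRel_quotientGroup_mk_iff H K a b).2 (Quotient.sound hab)))
    ⟨?_, ?_⟩
  · rintro ⟨a⟩ ⟨b⟩ hab
    exact (orbitRel_quotientGroup_mk_iff H K a b).1 (Quotient.exact hab)
  · rintro ⟨x⟩
    induction x using QuotientGroup.induction_on with
    | H g => exact ⟨DoubleCoset.mk H K g, rfl⟩

/-! ### Orbit counting: `|L| · #(X/L) = Σ_x |Stab_L(x)|` -/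

/-- **`|L| · #(X/L) = Σ_{x ∈ X} |Stab_L(x)|`** for a finite group `L` acting on a finite set `X` («the cardinality of
the orbit of `g_i` under `H` is `[H : K^{g_i⁻¹} ∩ H]`», summed over `I_K`; Burnside's bijection
`Σ_g Fix(g) ≃ (X/L) × L` read through `Σ_g |Fix(g)| = Σ_x |Stab(x)|`). [cite: Rojas2007, Lemma 3.3 (proof), p. 403] -/
theorem card_mul_natCard_orbitRel_quotient_eq_finsum (L : Type*) [Group L] [Finite L] {X : Type*} [Finite X]
    [MulAction L X] :
    Nat.card L * Nat.card (orbitRel.Quotient L X) = ∑ᶠ x : X, Nat.card (stabilizer L x) := by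
  classical
  haveI := Fintype.ofFinite X
  have e1 : (Σ x : X, stabilizer L x) ≃ (Σ g : L, fixedBy X g) :=
    ((Equiv.subtypeProdEquivSigmaSubtype fun (x : X) (g : L) ↦ g ∈ stabilizer L x).symm.trans
      ((Equiv.prodComm X L).subtypeEquiv fun _ ↦ Iff.rfl)).trans
      (Equiv.subtypeProdEquivSigmaSubtype fun (g : L) (x : X) ↦ x ∈ fixedBy X g)
  rw [finsum_eq_sum_of_fintype, ← Nat.card_sigma, Nat.card_congr (e1.trans (sigmaFixedByEquivOrbitsProdGroup L X)),
    Nat.card_prod, mul_comm]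

/-! ### Stabilizers on `I_K = G/K`: `Stab_G(gK) = gKg⁻¹`, `Stab_H(x) = Stab_G(x) ∩ H` -/

/-- **«The stabilizer of `g_i ∈ I_K` in `G` is `K^{g_i⁻¹}`»** `= g_iKg_i⁻¹`. [cite: Rojas2007, Lemma 3.3 (proof), p. 403] -/
theorem stabilizer_quotientGroup_mk (K : Subgroup G) (g : G) :
    stabilizer G (g : G ⧸ K) = K.map (MulAut.conj g).toMonoidHom := by
  rw [show (g : G ⧸ K) = g • ((1 : G) : G ⧸ K) by rw [MulAction.Quotient.smul_coe, smul_eq_mul, mul_one],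
    stabilizer_smul_eq_stabilizer_map_conj, MulAction.stabilizer_quotient]

/-- **«The stabilizer in `H` of an element `g_i ∈ I_K` is `K^{g_i⁻¹} ∩ H`»**: for a subgroup `H ≤ G` acting through
`G`, `|Stab_H(x)| = |Stab_G(x) ∩ H|`. [cite: Rojas2007, Lemma 3.3 (proof), p. 403] -/
theorem card_stabilizer_subgroup_eq {X : Type*} [MulAction G X] (H : Subgroup G) (x : X) :
    Nat.card (stabilizer H x) = Nat.card ↥(stabilizer G x ⊓ H) := by
  have h1 : stabilizer H x = (stabilizer G x).subgroupOf H := by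
    ext h
    simp only [mem_stabilizer_iff, Subgroup.mem_subgroupOf, Subgroup.smul_def]
  rw [h1, ← Subgroup.inf_subgroupOf_right]
  exact Nat.card_congr (Subgroup.subgroupOfEquivOfLe inf_le_right).toEquiv

/-! ### Grouping `Σ_{g ∈ G} F(gKg⁻¹)` along `G → G/K` and along `G → G/N_G(K)` -/

/-- **`Σ_{g ∈ G} φ(g) = |S| · Σ_{q ∈ G/S} φ(q̃)`** for `φ` constant on the left cosets of `S` (`q̃ = q.out` a left
transversal). [cite: Rojas2007, Lemma 3.3 (proof: «Taking all the representatives of left cosets of `N_G(K)` …»), p. 403] -/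
theorem finsum_eq_card_mul_finsum_quotient_out [Finite G] (S : Subgroup G) (φ : G → ℕ)
    (hφ : ∀ g : G, ∀ s ∈ S, φ (g * s) = φ g) :
    ∑ᶠ g : G, φ g = Nat.card S * ∑ᶠ q : G ⧸ S, φ q.out := by
  classical
  haveI := Fintype.ofFinite G
  have hout : ∀ g : G, φ g = φ (g : G ⧸ S).out := by
    intro g
    have hs : g⁻¹ * (g : G ⧸ S).out ∈ S := QuotientGroup.eq.1 (QuotientGroup.out_eq' (g : G ⧸ S)).symm
    rw [← hφ g _ hs, mul_inv_cancel_left]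
  have hfib : ∀ q : G ⧸ S, Fintype.card {g : G // (g : G ⧸ S) = q} = Nat.card S := by
    intro q
    rw [← Nat.card_eq_fintype_card,
      show Nat.card {g : G // (g : G ⧸ S) = q} = Nat.card ↥(QuotientGroup.mk ⁻¹' ({q} : Set (G ⧸ S))) from rfl,
      Nat.card_congr (QuotientGroup.preimageMkEquivSubgroupProdSet S {q}), Nat.card_prod, Nat.card_coe_set_eq,
      Set.ncard_singleton, mul_one]
  have key := Fintype.sum_fiberwise' (QuotientGroup.mk (s := S)) fun q : G ⧸ S ↦ φ q.out
  simp only [Finset.sum_const, Finset.card_univ, smul_eq_mul, hfib] at key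
  rw [finsum_eq_sum_of_fintype, finsum_eq_sum_of_fintype, Finset.mul_sum,
    Finset.sum_congr rfl fun g _ ↦ hout g, ← key]

/-- `gkKk⁻¹g⁻¹ = gKg⁻¹` for `k ∈ K`, more generally for `k ∈ N_G(K)`. [cite: Rojas2007, §3 (p. 401), Lemma 3.3 (proof), p. 403] -/
theorem map_conj_mul_of_mem_normalizer (K : Subgroup G) (g : G) {n : G}
    (hn : n ∈ Subgroup.normalizer (K : Set G)) :
    K.map (MulAut.conj (g * n)).toMonoidHom = K.map (MulAut.conj g).toMonoidHom := by
  have h1 : K.map (MulAut.conj n).toMonoidHom = K := by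
    rw [MulEquiv.toMonoidHom_eq_coe]
    exact Subgroup.mem_normalizer_iff_map_conj_eq.1 hn
  conv_rhs => rw [← h1, Subgroup.map_map]
  congr 1
  ext x
  simp [MulAut.conj_apply, mul_assoc]

/-- `|N_G(K)| = |K| · [N_G(K) : K]`. [cite: Rojas2007, Lemma 3.3 (proof: «each package has `[N_G(K) : K]` points»), p. 403] -/
theorem card_normalizer_eq_card_mul_relIndex [Finite G] (K : Subgroup G) :
    Nat.card ↥(Subgroup.normalizer (K : Set G)) = Nat.card K * K.relIndex (Subgroup.normalizer (K : Set G)) := by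
  rw [Subgroup.relIndex, ← Nat.card_congr (Subgroup.subgroupOfEquivOfLe (Subgroup.le_normalizer (H := K))).toEquiv,
    Subgroup.card_mul_index]

/-- **«`I_K` divided into `[G : N_G(K)]` packages, and each package has `[N_G(K) : K]` points associated to the same
stabilizer»**: for any function `F` of subgroups, `Σ_{x ∈ G/K} F(Stab_G x) = [N_G(K) : K] · Σ_{q ∈ G/N_G(K)} F(q̃Kq̃⁻¹)`
(both sides are `Σ_{g ∈ G} F(gKg⁻¹)` divided by `|K|`). [cite: Rojas2007, Lemma 3.3 (proof), p. 403] -/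
theorem finsum_stabilizer_quotient_eq_relIndex_mul_finsum [Finite G] (K : Subgroup G) (F : Subgroup G → ℕ) :
    ∑ᶠ x : G ⧸ K, F (stabilizer G x) =
      K.relIndex (Subgroup.normalizer (K : Set G)) *
        ∑ᶠ q : G ⧸ Subgroup.normalizer (K : Set G), F (K.map (MulAut.conj q.out).toMonoidHom) := by
  have h1 : ∑ᶠ g : G, F (K.map (MulAut.conj g).toMonoidHom) = Nat.card K * ∑ᶠ x : G ⧸ K, F (stabilizer G x) := by
    rw [finsum_eq_card_mul_finsum_quotient_out K (fun g ↦ F (K.map (MulAut.conj g).toMonoidHom))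
      (fun g k hk ↦ by simp only [map_conj_mul_of_mem_normalizer K g (Subgroup.le_normalizer hk)])]
    congr 1
    exact finsum_congr fun x ↦ by rw [← stabilizer_quotientGroup_mk, QuotientGroup.out_eq']
  have h2 : ∑ᶠ g : G, F (K.map (MulAut.conj g).toMonoidHom) =
      Nat.card ↥(Subgroup.normalizer (K : Set G)) *
        ∑ᶠ q : G ⧸ Subgroup.normalizer (K : Set G), F (K.map (MulAut.conj q.out).toMonoidHom) :=
    finsum_eq_card_mul_finsum_quotient_out (Subgroup.normalizer (K : Set G))
      (fun g ↦ F (K.map (MulAut.conj g).toMonoidHom))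
      fun g n hn ↦ by simp only [map_conj_mul_of_mem_normalizer K g hn]
  have h := h1.symm.trans h2
  rw [card_normalizer_eq_card_mul_relIndex, mul_assoc] at h
  exact Nat.eq_of_mul_eq_mul_left Nat.card_pos h

/-! ### Lemma 3.3 -/

/-- **`|H| · |H\G/K| = Σ_{x ∈ G/K} |Stab_G(x) ∩ H|`** («the stabilizer in `H` of an element `g_i ∈ I_K` is
`K^{g_i⁻¹} ∩ H` … the cardinality of the orbit `|O_H(g_iK)|` is `|H|/|K^{g_i⁻¹} ∩ H|`», summed).
[cite: Rojas2007, Lemma 3.3 (proof), p. 403] -/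
theorem card_mul_natCard_doubleCoset_quotient_eq_finsum [Finite G] (H K : Subgroup G) :
    Nat.card H * Nat.card (DoubleCoset.Quotient (H : Set G) K) =
      ∑ᶠ x : G ⧸ K, Nat.card ↥(stabilizer G x ⊓ H) := by
  rw [← natCard_orbitRel_quotient_eq_natCard_doubleCoset, card_mul_natCard_orbitRel_quotient_eq_finsum]
  exact finsum_congr fun x ↦ card_stabilizer_subgroup_eq H x

/-- **LEMMA 3.3: `|H\G/K| = Σ_{l ∈ Ω_K} [N_G(K) : K] · |K^{l⁻¹} ∩ H| / |H|`**, cleared of the denominator: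
`|H| · |H\G/K| = [N_G(K) : K] · Σ_{q ∈ G/N_G(K)} |q̃ K q̃⁻¹ ∩ H|` with `q̃ = q.out` a left transversal of `N_G(K)`.
[cite: Rojas2007, Lemma 3.3, p. 403] -/
theorem card_mul_natCard_doubleCoset_quotient [Finite G] (H K : Subgroup G) :
    Nat.card H * Nat.card (DoubleCoset.Quotient (H : Set G) K) =
      K.relIndex (Subgroup.normalizer (K : Set G)) *
        ∑ᶠ q : G ⧸ Subgroup.normalizer (K : Set G),
          Nat.card ↥(K.map (MulAut.conj q.out).toMonoidHom ⊓ H) := by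
  rw [card_mul_natCard_doubleCoset_quotient_eq_finsum]
  exact finsum_stabilizer_quotient_eq_relIndex_mul_finsum K fun S ↦ Nat.card ↥(S ⊓ H)

end Literature.GroupTheory.PermutationGroups
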